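import Literature.NumberTheory.PAdicHodge.LogCyclotomicCupProductTrace
import Literature.NumberTheory.PAdicHodge.PeriodLineTwist
import HarnessLib

/-!
# The assembly socket of Kato's reciprocity law on cochains: a recognition identity
# `p^k · g ≡ log χ · ℓ_u (mod ι∘C(Γ, ℤ_p(1)) + Z¹(Γ, B_dR⁺))` with `log_p u = p^k a` gives `⟨[η],[κ]⟩ = −Tr_{F/ℚ_p}(a)`

Topic `Literature/NumberTheory/PAdicHodge`; THEOREMS ONLY (no definition, no named fact, no instance, no `sorry`). This file is the
INSTANTIATION of `IsCoboundaryLift.twoCocycleClass_eq` (edix-p4 g18, `ContinuousCohomologyCoboundaryLift`) announced in the memos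
`Cruxes/StarredOptimalManinUnitFiveSeven/Lines/kato-lever-K3-floor-b.md` §2 item 4 and `kato-lever-K3-H1-right.md` §2: both sides of Kato's
Lemma 1.4.3 comparison live in ONE ambient `B_dR⁺(F)` (`BdRPlusTop F p`, `π = galRepr`, `ι = periodLine : ℤ_p(1) → B_dR⁺`): the cochain `g`
presenting `η ∪_{e_∞} κ` (`TatePairingCochainFilOne`) and the calibration cochain `τ ↦ log χ(τ) · ℓ_u` presenting `κ_u ∪ log χ`
(`TateTwistPeriodLine` §5); `inv_∞` of the latter is `−Tr_{F/ℚ_p}(log_p u)` (`LogCyclotomicCupProductTrace`, edix-p4 g20). HERE: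

* §1 (any `p`-adic `F`, valuation side) ★ `PadicField.exists_unitLog_eq_pow_smul` — **every `a ∈ F` is `p^{-k} log_p u` for some `k` and
  some unit `u ∈ 𝒪_Fˣ`** (`p^a 𝒪 ⊆ log_p(𝒪ˣ)`, IUT `pBall_logRadiusA_subset_logUnits`, through the bridge `PadicFieldSpectralNorm`): ONE unit
  calibrates any prescribed value `a` — the reduction «it suffices to treat `a = log u`» of Kato's proof of Lemma 1.4.5 WITHOUT the
  `F`-linear structure on `H¹(F, ℂ_F)`.
* §2 (any `p`-adic `F`) ★ `BdRPlusTop.eq_zero_of_periodLine_mem_ideal_sq` (`ℤ_p · t ∩ Fil² = 0`: `t = ξ · unit`, `θ(ℚ_p) ∩ ker θ = 0`),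
  ★ `BdRPlusTop.cocycle_eq_zero_of_isCoboundaryLift_of_forall_mem_sq` (a `Fil²`-VALUED cochain presenting a `ℤ_p(1)`-cocycle through `ι`
  presents `0`), `BdRPlusTop.qpToBdR_mul_isCocycle_of_gal_eq` / `…_embBdRHom_isCocycle` (`τ ↦ ψ(τ)·a`, `a ∈ F`, is a `1`-cocycle of
  `B_dR⁺` — the term absorbed in `z` when `ℓ_u` is replaced by `ℓ_u + log_p u = log[ũ]`) and ★★ `BdRPlusTop.twoCocycleClass_eq_of_sub_mem_sq`
  — **`IsCoboundaryLift.twoCocycleClass_eq` MODULO `Fil²`**: if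
  `g ≡ f + ι∘h + z (mod Fil² B_dR⁺)` pointwise then the presented classes agree — Kato's / the LEAD's «reducing modulo `Fil²` nothing is
  lost», i.e. the recognition may be performed in `B₂ = B_dR⁺/Fil²` (home of `X₂`).
* §3 (a completion `F = K_v`, `v ∣ p`; instances as binders) ★★ `invPadic_twoCocycleClass_eq_neg_trace_of_recognition` — **THE SOCKET**:
  if `g : Γ_F → B_dR⁺` presents the `ℤ_p(1)`-valued `2`-cocycle `c` through `ι`, `ψ` is a `ℤ_p`-lift of `log χ_cyclo`, `u` a unit with
  `log_p u = p^k · a`, and the RECOGNITION IDENTITY `p^k · g(τ) = ψ(τ) · ℓ_u + ι(h τ) + z(τ)` holds with `h : Γ_F → ℤ_p(1)` continuous and `z`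
  a `1`-cocycle of `B_dR⁺`, then **`inv_∞[c] = −Tr_{F/ℚ_p}(a)` in `ℚ_p`** (`[c^{p^k}] = [κ_u ∪ ψ]` by `twoCocycleClass_eq`;
  `inv_∞[c^{p^k}] = p^k inv_∞[c]` by `invPadic_twoCocycleClass_twistCocycle₂`; `inv_∞[κ_u ∪ ψ] = −Tr(log_p u) = −p^k Tr(a)`).
  ★★ `invPadic_twoCocycleClass_eq_neg_trace_of_recognition_mod_sq` — the same with the recognition identity only MODULO `Fil²`;
  ★★ `tatePairing_eq_neg_trace_of_recognition` / `tatePairingPoint_eq_neg_trace_of_recognition` — the same (mod `Fil²`) read on the tree's local Tate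
  pairing `⟨[η], [κ]⟩` / `⟨[η], P⟩` (`c = e_∞.cupCocycle η κ`, `tatePairing_oneCocycleClass_eq_invPadic_twoCocycleClass`,
  `tatePairingPoint_eq_invPadic_cupProduct`): with `a = −c₀ · exp*_d(η) · log_ω P` this IS the displayed formula of
  `EllipticCurves.tatePairingPoint_eq_trace_expStar_log` at `(η, P)`. So [REC] at a completion is reduced to producing, for each `(η, P)`,
  the recognition data `(k, u, h, z)` — the (H4) step (Kato's `X`, the LEAD's `X₂ ⊂ B₂`), and nothing else.

Line `kato_lever` of crux K★ `stmt-BirchSwinnertonDyer-22226`; BSD / K★ / [REC] are NOT proved by any of this (the recognition identity is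
a HYPOTHESIS here).

## References
* K. Kato, LNM 1553 (1993), Ch. II Thm. 1.4.1 (3)–(4), Lemma 1.4.3–1.4.5, §1.4.4. [Kato1993LNM1553]
* J. Neukirch, A. Schmidt, K. Wingberg (2008), I §3 (1.3.2) (connecting map on cochains). [NeukirchSchmidtWingberg2008]
* J. Neukirch, *Algebraic Number Theory* (1999), Ch. II (5.5). [NeukirchANT1999]
* J.-M. Fontaine, *Le corps des périodes p-adiques*, Astérisque 223 (1994), Exp. II §1.5.5. [FontaineAsterisque223III]
-/

noncomputable section

open Field Function ValuativeRel WittVector NumberField IsDedekindDomain Filter Topology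
open scoped NumberField

namespace Literature.NumberTheory.PAdicHodge

open Literature.NumberTheory.GaloisRepresentations
open Literature.NumberTheory.GaloisRepresentations.IsNonarchimedeanLocalField
open Literature.NumberTheory.GaloisCohomology
open Literature.NumberTheory.EllipticCurves
open Literature.IUT.LogVolume
open _root_.WeierstrassCurve

/-! ## §1 One unit calibrates any `a ∈ F` -/

namespace PadicField

variable (F : Type) [Field F] [ValuativeRel F] [TopologicalSpace F] [IsNonarchimedeanLocalField F] [CharZero F]
  (p : ℕ) [hprime : Fact p.Prime] (hp : valuation F p < 1)

/-- ★ **Every `a ∈ F` is `p^{-k} · log_p u` for some `k ∈ ℕ` and some unit `u ∈ 𝒪_Fˣ`**: `p^k a` lies in the ball `p^{a₀} 𝒪 ⊆ log_p(𝒪ˣ)`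
for `k ≫ 0` (IUT `pBall_logRadiusA_subset_logUnits`, instances from `PadicFieldSpectralNorm`), and the unit sphere of the `ℚ_p`-normalised
norm is `{valuation = 1}` (`norm_eq_one_iff`). [cite: NeukirchANT1999, Ch. II (5.5)] [cite: Kato1993LNM1553, Ch. II proof of Lemma 1.4.5] -/
theorem exists_unitLog_eq_pow_smul (a : F) :
    ∃ (k : ℕ) (u : F), valuation F u = 1 ∧
      (letI := LocalField.padicAlgebra F p hp; letI := normedField F p hp; unitLog u = ((p : ℚ_[p]) ^ k) • a) := by
  letI := LocalField.padicAlgebra F p hp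
  letI := normedField F p hp
  letI := normedAlgebra F p hp
  haveI := isUltrametricDist F p hp
  haveI := properSpace F p hp
  have hsub := pBall_logRadiusA_subset_logUnits p F
  have hp0 : (0 : ℝ) < p := by exact_mod_cast hprime.out.pos
  have hp1 : (1 : ℝ) < p := by exact_mod_cast hprime.out.one_lt
  obtain ⟨N, hN⟩ : ∃ N : ℕ, ‖a‖ * ((p : ℝ)⁻¹) ^ N ≤ (p : ℝ) ^ (-logRadiusA p (absRamificationIdx p F)) := by
    have ht : Tendsto (fun N : ℕ => ‖a‖ * ((p : ℝ)⁻¹) ^ N) atTop (𝓝 (‖a‖ * 0)) :=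
      (tendsto_pow_atTop_nhds_zero_of_lt_one (inv_pos.2 hp0).le (inv_lt_one_of_one_lt₀ hp1)).const_mul _
    rw [mul_zero] at ht
    exact (ht.eventually (eventually_le_nhds (Real.rpow_pos_of_pos hp0 _))).exists
  have hmem : ((p : ℚ_[p]) ^ N) • a ∈ logUnits F := by
    apply hsub
    rw [mem_pBall_iff, norm_smul, norm_pow, Padic.norm_p, mul_comm]
    exact hN
  obtain ⟨u, hu, hlog⟩ := mem_logUnits_iff.1 hmem
  exact ⟨N, u, (norm_eq_one_iff F p hp u).1 hu, hlog⟩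

end PadicField

/-! ## §2 `Fil²`-valued errors are invisible: `twoCocycleClass_eq` modulo `Fil²` -/

namespace BdRPlusTop

variable {F : Type} [Field F] [ValuativeRel F] [TopologicalSpace F] [IsNonarchimedeanLocalField F] [CharZero F]
  {p : ℕ} [Fact p.Prime] [Fact (¬ IsUnit (p : integerC F))] [IsAdicComplete (Ideal.span {(p : integerC F)}) (integerC F)]

/-- `σ(Filⁿ) ⊆ Filⁿ`: the powers of `Fil¹ = (ξ)` are `Γ_F`-stable (`σ(ξ) ∈ (ξ)`, `ideal_map_gal_le`). [cite: Kato1993LNM1553, Ch. II §1.1] -/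
theorem gal_mem_ideal_pow (σ : absoluteGaloisGroup F) (n : ℕ) {x : BdRPlusTop F p}
    (hx : x ∈ (WithIdeal.i ^ n : Ideal (BdRPlusTop F p))) : gal F p σ x ∈ (WithIdeal.i ^ n : Ideal (BdRPlusTop F p)) := by
  have hle : (WithIdeal.i ^ n : Ideal (BdRPlusTop F p)).map (gal F p σ) ≤ WithIdeal.i ^ n := by
    rw [Ideal.map_pow]
    exact Ideal.pow_right_mono (ideal_map_gal_le σ) n
  exact hle (Ideal.mem_map_of_mem _ hx)

/-- ★ **`ℤ_p · t ∩ Fil² B_dR⁺ = 0`**: if `ι(ζ) = a · t ∈ (ξ)²` then `ζ = 0` — `t = ξ · w` with `w` a unit (`exists_tBdR_eq_xiBdR_mul`), so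
`ξ ∣ a`, `θ(a) = 0`, and `θ` is injective on `ℚ_p ⊆ F` (`thetaBdR_qpToBdR`). [cite: Kato1993LNM1553, Ch. II §1.1 and §1.4 (proof of Lemma 1.4.3)] -/
theorem eq_zero_of_periodLine_mem_ideal_sq (hp : valuation F p < 1) (hF : Function.Surjective (fontaineTheta (integerC F) p))
    {ζ : (muPadicSystem F p).limit} (hζ : periodLine F p ζ ∈ (WithIdeal.i ^ 2 : Ideal (BdRPlusTop F p))) : ζ = 0 := by
  haveI := isDomain_bDeRhamPlus (F := F) (p := p) hF
  set a : ℤ_[p] := (epsLineEquiv F p).symm ζ with ha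
  -- `ξ² ∣ a · t` in `B_dR⁺`
  have hdvd : (xiBdR : BDeRhamPlus (integerC F) p) ^ 2 ∣ qpToBdR (a : ℚ_[p]) * tBdR := by
    rw [ideal_eq, Ideal.span_singleton_pow, Ideal.mem_span_singleton, periodLine_apply] at hζ
    obtain ⟨y, hy⟩ := hζ
    exact ⟨(of F p).symm y, by simpa using congrArg (of F p).symm hy⟩
  obtain ⟨w, hw, htw⟩ := exists_tBdR_eq_xiBdR_mul (F := F) (p := p) hF
  have hxi : (xiBdR : BDeRhamPlus (integerC F) p) ≠ 0 := fun h =>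
    one_ne_zero (eq_zero_of_xiBdR_mul_eq_zero (F := F) (p := p) (x := 1) (by rw [h, zero_mul]))
  rw [htw, mul_left_comm, pow_two, mul_dvd_mul_iff_left hxi, hw.dvd_mul_right] at hdvd
  -- hence `θ(a) = 0`, so `a = 0`
  have hθ : thetaBdR (qpToBdR (a : ℚ_[p]) : BDeRhamPlus (integerC F) p) = 0 := by
    rw [← RingHom.mem_ker, ker_thetaBdR_eq_span]
    exact Ideal.mem_span_singleton.2 hdvd
  rw [thetaBdR_qpToBdR hp, map_eq_zero_iff _ (algebraMap F (CompletedAlgClosure F)).injective,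
    map_eq_zero_iff _ (algebraMap (PadicBase F p hp) F).injective, map_eq_zero_iff _ (PadicBase.toPadic hp).symm.injective,
    PadicInt.coe_eq_zero] at hθ
  rw [← (epsLineEquiv F p).apply_symm_apply ζ, ← ha, hθ, map_zero]

/-- ★ **A `Fil²`-valued cochain presenting a `ℤ_p(1)`-valued cocycle through the period line presents `0`**: `ι(d(σ,τ)) =
σ w(τ) − w(στ) + w(σ) ∈ Fil² ∩ ℤ_p · t = 0`. [cite: Kato1993LNM1553, Ch. II §1.4 (proof of Lemma 1.4.3)] [cite: NeukirchSchmidtWingberg2008, I §3 (1.3.2)] -/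
theorem cocycle_eq_zero_of_isCoboundaryLift_of_forall_mem_sq (hp : valuation F p < 1)
    (hF : Function.Surjective (fontaineTheta (integerC F) p)) {w : absoluteGaloisGroup F → BdRPlusTop F p}
    {d : contTwoCocycles (tateModuleMuPadic F p).toTopRep}
    (hw : IsCoboundaryLift (ρ := tateModuleMuPadic F p) (galRepr F p) (periodLine F p) w d)
    (hmem : ∀ τ, w τ ∈ (WithIdeal.i ^ 2 : Ideal (BdRPlusTop F p))) : d = 0 := by
  refine Subtype.ext (ContinuousMap.ext fun q => ?_)
  obtain ⟨σ, τ⟩ := q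
  change d.1 (σ, τ) = 0
  refine eq_zero_of_periodLine_mem_ideal_sq hp hF ?_
  rw [hw σ τ, galRepr_apply]
  exact Ideal.add_mem _ (Ideal.sub_mem _ (gal_mem_ideal_pow σ 2 (hmem τ)) (hmem _)) (hmem σ)

/-- **`τ ↦ ψ(τ) · b` is a `1`-cocycle of `B_dR⁺` for `Γ_F`-invariant `b`** and additive `ψ : Γ_F → ℤ_p` (the term absorbed in `z` when a
calibration cochain `ψ · ℓ_u` is replaced by `ψ · (ℓ_u + b)`, e.g. `b = log_p u ∈ F`). [cite: NeukirchSchmidtWingberg2008, I §3 (1.3.2)] -/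
theorem qpToBdR_mul_isCocycle_of_gal_eq {ψ : absoluteGaloisGroup F → ℤ_[p]} (hψ : ∀ σ τ, ψ (σ * τ) = ψ σ + ψ τ)
    {b : BdRPlusTop F p} (hb : ∀ σ, gal F p σ b = b) (σ τ : absoluteGaloisGroup F) :
    of F p (qpToBdR ((ψ (σ * τ) : ℤ_[p]) : ℚ_[p])) * b =
      of F p (qpToBdR ((ψ σ : ℤ_[p]) : ℚ_[p])) * b + galRepr F p σ (of F p (qpToBdR ((ψ τ : ℤ_[p]) : ℚ_[p])) * b) := by
  rw [galRepr_apply, map_mul, gal_of, galBdRPlus_qpToBdR, hb, hψ, PadicInt.coe_add, map_add, map_add, add_mul]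

/-- Elements of `F ⊆ B_dR⁺` (`embBdRHom`) are `Γ_F`-invariant, so `τ ↦ ψ(τ) · a` (`a ∈ F`) is a `1`-cocycle of `B_dR⁺`.
[cite: FontaineAsterisque223III, Exp. II §1.5.5] [cite: NeukirchSchmidtWingberg2008, I §3 (1.3.2)] -/
theorem qpToBdR_mul_embBdRHom_isCocycle (hp : valuation F p < 1) (hF : Function.Surjective (fontaineTheta (integerC F) p))
    {ψ : absoluteGaloisGroup F → ℤ_[p]} (hψ : ∀ σ τ, ψ (σ * τ) = ψ σ + ψ τ) (a : F) (σ τ : absoluteGaloisGroup F) :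
    of F p (qpToBdR ((ψ (σ * τ) : ℤ_[p]) : ℚ_[p])) * of F p (embBdRHom hp hF a) =
      of F p (qpToBdR ((ψ σ : ℤ_[p]) : ℚ_[p])) * of F p (embBdRHom hp hF a) +
        galRepr F p σ (of F p (qpToBdR ((ψ τ : ℤ_[p]) : ℚ_[p])) * of F p (embBdRHom hp hF a)) :=
  qpToBdR_mul_isCocycle_of_gal_eq hψ (fun σ => by rw [gal_of, galBdRPlus_embBdRHom]) σ τ

variable [LocallyCompactSpace (absoluteGaloisGroup F)]

/-- ★★ **`IsCoboundaryLift.twoCocycleClass_eq` MODULO `Fil²`** («reducing modulo `Fil²` nothing is lost»): if `g` presents `c` and `f`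
presents `c₀` through the period line, and `g(τ) − (f(τ) + ι(h τ) + z(τ)) ∈ Fil² B_dR⁺` for all `τ`, with `h : Γ_F → ℤ_p(1)` continuous and
`z` a `1`-cocycle of `B_dR⁺`, then `[c] = [c₀]` in `H²(F, ℤ_p(1))` (indeed `c = c₀ + ∂h`). So the recognition of a presenting cochain may be
carried out in `B₂ = B_dR⁺/Fil²`. [cite: Kato1993LNM1553, Ch. II §1.4 (proof of Lemma 1.4.3)] [cite: NeukirchSchmidtWingberg2008, I §3 (1.3.2)] -/
theorem twoCocycleClass_eq_of_sub_mem_sq (hp : valuation F p < 1) (hF : Function.Surjective (fontaineTheta (integerC F) p))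
    {g f : absoluteGaloisGroup F → BdRPlusTop F p} {c c₀ : contTwoCocycles (tateModuleMuPadic F p).toTopRep}
    (hg : IsCoboundaryLift (ρ := tateModuleMuPadic F p) (galRepr F p) (periodLine F p) g c)
    (hf : IsCoboundaryLift (ρ := tateModuleMuPadic F p) (galRepr F p) (periodLine F p) f c₀)
    (h : C(absoluteGaloisGroup F, (muPadicSystem F p).limit)) (z : absoluteGaloisGroup F → BdRPlusTop F p)
    (hz : ∀ σ τ, z (σ * τ) = z σ + galRepr F p σ (z τ))
    (e : ∀ τ, g τ - (f τ + periodLine F p (h τ) + z τ) ∈ (WithIdeal.i ^ 2 : Ideal (BdRPlusTop F p))) :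
    twoCocycleClass _ c = twoCocycleClass _ c₀ := by
  -- `f + ι∘h + z` presents `c₀ + ∂h`; the `Fil²`-valued difference presents `c − (c₀ + ∂h)`, hence `0`
  have h1 : IsCoboundaryLift (ρ := tateModuleMuPadic F p) (galRepr F p) (periodLine F p)
      (fun τ => f τ + periodLine F p (h τ) + z τ) (c₀ + (tateModuleMuPadic F p).twoCoboundary h) :=
    ((hf.add_twoCoboundary (periodLine_tateModuleMuPadic_eq_galRepr (F := F) (p := p)) h).add_cocycle hz).congr
      fun σ => by simp only [Pi.add_apply]
  have h2 := hg.sub h1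
  have h0 : c - (c₀ + (tateModuleMuPadic F p).twoCoboundary h) = 0 :=
    cocycle_eq_zero_of_isCoboundaryLift_of_forall_mem_sq hp hF h2 fun τ => by simpa only [Pi.sub_apply] using e τ
  rw [sub_eq_zero] at h0
  rw [h0, twoCocycleClass_add, ContinuousRep.twoCocycleClass_twoCoboundary, add_zero]

end BdRPlusTop

/-! ## §3 The socket at a completion -/

section Completion

variable {K : Type} [Field K] [NumberField K] {p : ℕ} [hprime : Fact p.Prime] (v : HeightOneSpectrum (𝓞 K))
  [CharZero (v.adicCompletion K)] [LocallyCompactSpace (absoluteGaloisGroup (v.adicCompletion K))]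
  [Fact (¬ IsUnit (p : integerC (v.adicCompletion K)))]
  [IsAdicComplete (Ideal.span {(p : integerC (v.adicCompletion K))}) (integerC (v.adicCompletion K))]

/-- ★ **Core of the socket**: if `[c^{p^k}] = [κ_u ∪ ψ]` in `H²(K_v, ℤ_p(1))` for a `ℤ_p`-lift `ψ` of `log χ_cyclo` and a unit `u` with
`log_p u = p^k · a`, then `inv_∞[c] = −Tr_{K_v/ℚ_p}(a)` (`inv_∞[c^{p^k}] = p^k inv_∞[c]`, `inv_∞[κ_u ∪ ψ] = −Tr(log_p u)`, `char ℚ_p = 0`).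
[cite: Kato1993LNM1553, Ch. II Lemma 1.4.5 and §1.4.4] -/
theorem invPadic_twoCocycleClass_eq_neg_trace_of_twist_class_eq
    (hpv : valuation (v.adicCompletion K) (p : v.adicCompletion K) < 1)
    (hF : Function.Surjective (fontaineTheta (integerC (v.adicCompletion K)) p))
    (ψ : C(absoluteGaloisGroup (v.adicCompletion K), ℤ_[p])) (hψ : ∀ σ τ, ψ (σ * τ) = ψ σ + ψ τ)
    (hψlog : ∀ τ, (ψ τ : ℚ_[p]) = logCyclotomic (F := v.adicCompletion K) p τ)
    {u : v.adicCompletion K} (hu : u ≠ 0) (hu1 : valuation (v.adicCompletion K) u = 1)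
    (a : v.adicCompletion K) (k : ℕ)
    (hlog : letI := LocalField.padicAlgebra (v.adicCompletion K) p hpv
      letI := PadicField.normedField (v.adicCompletion K) p hpv
      unitLog u = ((p : ℚ_[p]) ^ k) • a)
    {c : contTwoCocycles (tateModuleMuPadic (v.adicCompletion K) p).toTopRep}
    (hcls : twoCocycleClass _ (twistCocycle₂ ((p : ℤ_[p]) ^ k) c) = twoCocycleClass _
      ((twistPairingPadic (v.adicCompletion K) p).cupCocycle (BdRPlusTop.rootKummerCocycle p hu)
        (homOneCocycle (v.adicCompletion K) p ψ hψ))) :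
    letI := LocalField.padicAlgebra (v.adicCompletion K) p hpv
    ((invPadic (v.adicCompletion K) p (twoCocycleClass _ c) : ℤ_[p]) : ℚ_[p]) =
      -Algebra.trace ℚ_[p] (v.adicCompletion K) a := by
  letI := LocalField.padicAlgebra (v.adicCompletion K) p hpv
  have hcu := BdRPlusTop.isCoboundaryLift_twistPairingPadic_rootKummerCocycle hpv hF hu
    (norm_algebraMap_normedAlgClosure_le_one_of_valuation_le_one hu1.le) (homOneCocycle (v.adicCompletion K) p ψ hψ)
  have hinv : (p : ℤ_[p]) ^ k * invPadic (v.adicCompletion K) p (twoCocycleClass _ c) =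
      invPadic (v.adicCompletion K) p (twoCocycleClass _
        ((twistPairingPadic (v.adicCompletion K) p).cupCocycle (BdRPlusTop.rootKummerCocycle p hu)
          (homOneCocycle (v.adicCompletion K) p ψ hψ))) := by
    rw [← invPadic_twoCocycleClass_twistCocycle₂, hcls]
  have hval := invPadic_twoCocycleClass_eq_neg_trace_unitLog_of_logCyclotomic_presentation v hpv hF ψ hψ hψlog u hu hu1 hcu
  have hpk : ((p : ℚ_[p]) ^ k) ≠ 0 := pow_ne_zero k (Nat.cast_ne_zero.2 hprime.out.ne_zero)
  apply mul_left_cancel₀ hpk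
  calc (p : ℚ_[p]) ^ k * ((invPadic (v.adicCompletion K) p (twoCocycleClass _ c) : ℤ_[p]) : ℚ_[p])
      = (((p : ℤ_[p]) ^ k * invPadic (v.adicCompletion K) p (twoCocycleClass _ c) : ℤ_[p]) : ℚ_[p]) := by push_cast; ring
    _ = -Algebra.trace ℚ_[p] (v.adicCompletion K)
          (letI := PadicField.normedField (v.adicCompletion K) p hpv; unitLog u) := by rw [hinv]; exact hval
    _ = (p : ℚ_[p]) ^ k * -Algebra.trace ℚ_[p] (v.adicCompletion K) a := by
          rw [hlog, map_smul, smul_eq_mul, mul_neg]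

/-- ★★ **THE SOCKET (recognition modulo `Fil²`).** Let `F = K_v`, `v ∣ p`; `ψ : Γ_F → ℤ_p` a continuous additive lift of `log χ_cyclo`;
`u ∈ 𝒪_Fˣ` a unit and `a ∈ F`, `k ∈ ℕ` with `log_p u = p^k · a`; `g : Γ_F → B_dR⁺(F)` a cochain presenting the continuous `2`-cocycle `c`
of `ℤ_p(1)` through the period line. If the RECOGNITION IDENTITY `p^k · g(τ) ≡ ψ(τ) · ℓ_u + ι(h τ) + z(τ) (mod Fil² B_dR⁺)` holds for all
`τ`, with `h : Γ_F → ℤ_p(1)` continuous and `z` a `1`-cocycle of `B_dR⁺` (`z(στ) = z(σ) + σ z(τ)`), then **`inv_∞[c] = −Tr_{F/ℚ_p}(a)` in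
`ℚ_p`**. (`ℓ_u = unitKummerLog`; `Tr` for `LocalField.padicAlgebra`; `log_p` on `F` = `unitLog` for `PadicField.normedField`.)
[cite: Kato1993LNM1553, Ch. II Lemma 1.4.3–1.4.5 and §1.4.4] [cite: NeukirchSchmidtWingberg2008, I §3 (1.3.2)] -/
theorem invPadic_twoCocycleClass_eq_neg_trace_of_recognition_mod_sq
    (hpv : valuation (v.adicCompletion K) (p : v.adicCompletion K) < 1)
    (hF : Function.Surjective (fontaineTheta (integerC (v.adicCompletion K)) p))
    (ψ : C(absoluteGaloisGroup (v.adicCompletion K), ℤ_[p])) (hψ : ∀ σ τ, ψ (σ * τ) = ψ σ + ψ τ)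
    (hψlog : ∀ τ, (ψ τ : ℚ_[p]) = logCyclotomic (F := v.adicCompletion K) p τ)
    {u : v.adicCompletion K} (hu : u ≠ 0) (hu1 : valuation (v.adicCompletion K) u = 1)
    (a : v.adicCompletion K) (k : ℕ)
    (hlog : letI := LocalField.padicAlgebra (v.adicCompletion K) p hpv
      letI := PadicField.normedField (v.adicCompletion K) p hpv
      unitLog u = ((p : ℚ_[p]) ^ k) • a)
    {g : absoluteGaloisGroup (v.adicCompletion K) → BdRPlusTop (v.adicCompletion K) p}
    {c : contTwoCocycles (tateModuleMuPadic (v.adicCompletion K) p).toTopRep}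
    (hg : IsCoboundaryLift (ρ := tateModuleMuPadic (v.adicCompletion K) p) (BdRPlusTop.galRepr (v.adicCompletion K) p)
      (BdRPlusTop.periodLine (v.adicCompletion K) p) g c)
    (h : C(absoluteGaloisGroup (v.adicCompletion K), (muPadicSystem (v.adicCompletion K) p).limit))
    (z : absoluteGaloisGroup (v.adicCompletion K) → BdRPlusTop (v.adicCompletion K) p)
    (hz : ∀ σ τ, z (σ * τ) = z σ + BdRPlusTop.galRepr (v.adicCompletion K) p σ (z τ))
    (e : ∀ τ, BdRPlusTop.of (v.adicCompletion K) p (qpToBdR ((p : ℚ_[p]) ^ k)) * g τ -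
      (BdRPlusTop.of (v.adicCompletion K) p (qpToBdR ((ψ τ : ℤ_[p]) : ℚ_[p])) *
          BdRPlusTop.unitKummerLog hpv hF hu (norm_algebraMap_normedAlgClosure_le_one_of_valuation_le_one hu1.le) +
        BdRPlusTop.periodLine (v.adicCompletion K) p (h τ) + z τ) ∈
        (WithIdeal.i ^ 2 : Ideal (BdRPlusTop (v.adicCompletion K) p))) :
    letI := LocalField.padicAlgebra (v.adicCompletion K) p hpv
    ((invPadic (v.adicCompletion K) p (twoCocycleClass _ c) : ℤ_[p]) : ℚ_[p]) =
      -Algebra.trace ℚ_[p] (v.adicCompletion K) a := by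
  refine invPadic_twoCocycleClass_eq_neg_trace_of_twist_class_eq v hpv hF ψ hψ hψlog hu hu1 a k hlog ?_
  have hc' := BdRPlusTop.isCoboundaryLift_qpToBdR_mul_twist hg ((p : ℤ_[p]) ^ k)
  have hcu := BdRPlusTop.isCoboundaryLift_twistPairingPadic_rootKummerCocycle hpv hF hu
    (norm_algebraMap_normedAlgClosure_le_one_of_valuation_le_one hu1.le) (homOneCocycle (v.adicCompletion K) p ψ hψ)
  exact BdRPlusTop.twoCocycleClass_eq_of_sub_mem_sq hpv hF hc' hcu h z hz fun τ => by
    rw [homOneCocycle_apply, PadicInt.coe_pow, PadicInt.coe_natCast]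
    exact e τ

/-- ★★ **THE SOCKET (exact recognition identity)**: as above with `p^k · g(τ) = ψ(τ) · ℓ_u + ι(h τ) + z(τ)` on the nose.
[cite: Kato1993LNM1553, Ch. II Lemma 1.4.3–1.4.5 and §1.4.4] [cite: NeukirchSchmidtWingberg2008, I §3 (1.3.2)] -/
theorem invPadic_twoCocycleClass_eq_neg_trace_of_recognition
    (hpv : valuation (v.adicCompletion K) (p : v.adicCompletion K) < 1)
    (hF : Function.Surjective (fontaineTheta (integerC (v.adicCompletion K)) p))
    (ψ : C(absoluteGaloisGroup (v.adicCompletion K), ℤ_[p])) (hψ : ∀ σ τ, ψ (σ * τ) = ψ σ + ψ τ)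
    (hψlog : ∀ τ, (ψ τ : ℚ_[p]) = logCyclotomic (F := v.adicCompletion K) p τ)
    {u : v.adicCompletion K} (hu : u ≠ 0) (hu1 : valuation (v.adicCompletion K) u = 1)
    (a : v.adicCompletion K) (k : ℕ)
    (hlog : letI := LocalField.padicAlgebra (v.adicCompletion K) p hpv
      letI := PadicField.normedField (v.adicCompletion K) p hpv
      unitLog u = ((p : ℚ_[p]) ^ k) • a)
    {g : absoluteGaloisGroup (v.adicCompletion K) → BdRPlusTop (v.adicCompletion K) p}
    {c : contTwoCocycles (tateModuleMuPadic (v.adicCompletion K) p).toTopRep}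
    (hg : IsCoboundaryLift (ρ := tateModuleMuPadic (v.adicCompletion K) p) (BdRPlusTop.galRepr (v.adicCompletion K) p)
      (BdRPlusTop.periodLine (v.adicCompletion K) p) g c)
    (h : C(absoluteGaloisGroup (v.adicCompletion K), (muPadicSystem (v.adicCompletion K) p).limit))
    (z : absoluteGaloisGroup (v.adicCompletion K) → BdRPlusTop (v.adicCompletion K) p)
    (hz : ∀ σ τ, z (σ * τ) = z σ + BdRPlusTop.galRepr (v.adicCompletion K) p σ (z τ))
    (e : ∀ τ, BdRPlusTop.of (v.adicCompletion K) p (qpToBdR ((p : ℚ_[p]) ^ k)) * g τ =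
      BdRPlusTop.of (v.adicCompletion K) p (qpToBdR ((ψ τ : ℤ_[p]) : ℚ_[p])) *
          BdRPlusTop.unitKummerLog hpv hF hu (norm_algebraMap_normedAlgClosure_le_one_of_valuation_le_one hu1.le) +
        BdRPlusTop.periodLine (v.adicCompletion K) p (h τ) + z τ) :
    letI := LocalField.padicAlgebra (v.adicCompletion K) p hpv
    ((invPadic (v.adicCompletion K) p (twoCocycleClass _ c) : ℤ_[p]) : ℚ_[p]) =
      -Algebra.trace ℚ_[p] (v.adicCompletion K) a :=
  invPadic_twoCocycleClass_eq_neg_trace_of_recognition_mod_sq v hpv hF ψ hψ hψlog hu hu1 a k hlog hg h z hz fun τ => by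
    rw [e τ, sub_self]; exact Ideal.zero_mem _

variable {K₀ : Type} [Field K₀] [CharZero K₀] (W : WeierstrassCurve K₀) [W.IsElliptic] [Algebra K₀ (v.adicCompletion K)]
  (e : (k : ℕ) → geomTorsion W ((p ^ k : ℕ) : ℤ) → geomTorsion W ((p ^ k : ℕ) : ℤ) → AlgebraicClosure K₀)
  (hμ : ∀ k S T, e k S T ^ (p ^ k) = 1) (hadd₁ : ∀ k S₁ S₂ T, e k (S₁ + S₂) T = e k S₁ T * e k S₂ T)
  (hadd₂ : ∀ k S T₁ T₂, e k S (T₁ + T₂) = e k S T₁ * e k S T₂)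
  (hgal : ∀ k (σ : absoluteGaloisGroup K₀) (S T : geomTorsion W ((p ^ k : ℕ) : ℤ)), σ • e k S T = e k (σ • S) (σ • T))
  (hcompat : ∀ k (S T : geomTorsion W ((p ^ (k + 1) : ℕ) : ℤ)),
    e k (torsionMulHom W (p ^ (k + 1)) (p ^ k) p (pow_succ p k).symm S)
      (torsionMulHom W (p ^ (k + 1)) (p ^ k) p (pow_succ p k).symm T) = e (k + 1) S T ^ p)

include hgal in
/-- ★★ **The socket read on the local Tate pairing of two cocycles**: with `c = e_∞.cupCocycle η κ` (any `B_dR⁺`-valued presentation `g` of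
it, e.g. the `Fil¹`-valued `g⁺` of `exists_isCoboundaryLift_bdRPlus_of_isFilZeroCoboundary`) and the recognition identity modulo `Fil²`,
**`⟨[η], [κ]⟩ = −Tr_{F/ℚ_p}(a)` in `ℚ_p`** (`tatePairing_oneCocycleClass_eq_invPadic_twoCocycleClass`).
[cite: Kato1993LNM1553, Ch. II Thm. 1.4.1 (3)–(4), Lemma 1.4.3–1.4.5] -/
theorem tatePairing_eq_neg_trace_of_recognition
    (hpv : valuation (v.adicCompletion K) (p : v.adicCompletion K) < 1)
    (hF : Function.Surjective (fontaineTheta (integerC (v.adicCompletion K)) p))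
    (ψ : C(absoluteGaloisGroup (v.adicCompletion K), ℤ_[p])) (hψ : ∀ σ τ, ψ (σ * τ) = ψ σ + ψ τ)
    (hψlog : ∀ τ, (ψ τ : ℚ_[p]) = logCyclotomic (F := v.adicCompletion K) p τ)
    {u : v.adicCompletion K} (hu : u ≠ 0) (hu1 : valuation (v.adicCompletion K) u = 1)
    (a : v.adicCompletion K) (k : ℕ)
    (hlog : letI := LocalField.padicAlgebra (v.adicCompletion K) p hpv
      letI := PadicField.normedField (v.adicCompletion K) p hpv
      unitLog u = ((p : ℚ_[p]) ^ k) • a)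
    (η κ : contOneCocycles (restrictedTateRep W (v.adicCompletion K) p).toTopRep)
    {g : absoluteGaloisGroup (v.adicCompletion K) → BdRPlusTop (v.adicCompletion K) p}
    (hg : IsCoboundaryLift (ρ := tateModuleMuPadic (v.adicCompletion K) p) (BdRPlusTop.galRepr (v.adicCompletion K) p)
      (BdRPlusTop.periodLine (v.adicCompletion K) p) g
      ((weilContPairingPadic W (v.adicCompletion K) p e hμ hadd₁ hadd₂ hgal hcompat).cupCocycle η κ))
    (h : C(absoluteGaloisGroup (v.adicCompletion K), (muPadicSystem (v.adicCompletion K) p).limit))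
    (z : absoluteGaloisGroup (v.adicCompletion K) → BdRPlusTop (v.adicCompletion K) p)
    (hz : ∀ σ τ, z (σ * τ) = z σ + BdRPlusTop.galRepr (v.adicCompletion K) p σ (z τ))
    (e_rec : ∀ τ, BdRPlusTop.of (v.adicCompletion K) p (qpToBdR ((p : ℚ_[p]) ^ k)) * g τ -
      (BdRPlusTop.of (v.adicCompletion K) p (qpToBdR ((ψ τ : ℤ_[p]) : ℚ_[p])) *
          BdRPlusTop.unitKummerLog hpv hF hu (norm_algebraMap_normedAlgClosure_le_one_of_valuation_le_one hu1.le) +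
        BdRPlusTop.periodLine (v.adicCompletion K) p (h τ) + z τ) ∈
        (WithIdeal.i ^ 2 : Ideal (BdRPlusTop (v.adicCompletion K) p))) :
    letI := LocalField.padicAlgebra (v.adicCompletion K) p hpv
    ((tatePairing W (v.adicCompletion K) p e hμ hadd₁ hadd₂ hgal hcompat (oneCocycleClass _ η) (oneCocycleClass _ κ) : ℤ_[p]) :
        ℚ_[p]) = -Algebra.trace ℚ_[p] (v.adicCompletion K) a := by
  rw [tatePairing_oneCocycleClass_eq_invPadic_twoCocycleClass]
  exact invPadic_twoCocycleClass_eq_neg_trace_of_recognition_mod_sq v hpv hF ψ hψ hψlog hu hu1 a k hlog hg h z hz e_rec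

include hgal in
/-- ★★ **The socket read on `⟨[η], P⟩ = tatePairingPoint`** — the literal left-hand side of `EllipticCurves.tatePairingPoint_eq_trace_expStar_log`:
for a Kummer cocycle `κ` of the point `P` (its level classes are the `kummerLevelClass`es of `P`), a presentation `g` of `e_∞.cupCocycle η κ` and
recognition data `(k, u, h, z)` for `a` modulo `Fil²`, **`⟨[η], P⟩ = −Tr_{F/ℚ_p}(a)` in `ℚ_p`**. With `a = −c₀ · exp*_d(η) · log_ω P` this is
Kato's formula at `(η, P)`: [REC] at a completion is reduced to the recognition data. [cite: Kato1993LNM1553, Ch. II Thm. 1.4.1 (3)–(4), Lemma 1.4.3–1.4.5]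
[cite: BlochKato1990, Ex. 3.10.1] -/
theorem tatePairingPoint_eq_neg_trace_of_recognition
    (hpv : valuation (v.adicCompletion K) (p : v.adicCompletion K) < 1)
    (hF : Function.Surjective (fontaineTheta (integerC (v.adicCompletion K)) p))
    (ψ : C(absoluteGaloisGroup (v.adicCompletion K), ℤ_[p])) (hψ : ∀ σ τ, ψ (σ * τ) = ψ σ + ψ τ)
    (hψlog : ∀ τ, (ψ τ : ℚ_[p]) = logCyclotomic (F := v.adicCompletion K) p τ)
    {u : v.adicCompletion K} (hu : u ≠ 0) (hu1 : valuation (v.adicCompletion K) u = 1)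
    (a : v.adicCompletion K) (k : ℕ)
    (hlog : letI := LocalField.padicAlgebra (v.adicCompletion K) p hpv
      letI := PadicField.normedField (v.adicCompletion K) p hpv
      unitLog u = ((p : ℚ_[p]) ^ k) • a)
    (η κ : contOneCocycles (restrictedTateRep W (v.adicCompletion K) p).toTopRep)
    (P : (W.baseChange (v.adicCompletion K)).toAffine.Point)
    (hκ : ∀ j, (cohomologyMap (tateProjMor W (v.adicCompletion K) p j) 1).hom (oneCocycleClass _ κ) =
      kummerLevelClass W (v.adicCompletion K) p j P)
    {g : absoluteGaloisGroup (v.adicCompletion K) → BdRPlusTop (v.adicCompletion K) p}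
    (hg : IsCoboundaryLift (ρ := tateModuleMuPadic (v.adicCompletion K) p) (BdRPlusTop.galRepr (v.adicCompletion K) p)
      (BdRPlusTop.periodLine (v.adicCompletion K) p) g
      ((weilContPairingPadic W (v.adicCompletion K) p e hμ hadd₁ hadd₂ hgal hcompat).cupCocycle η κ))
    (h : C(absoluteGaloisGroup (v.adicCompletion K), (muPadicSystem (v.adicCompletion K) p).limit))
    (z : absoluteGaloisGroup (v.adicCompletion K) → BdRPlusTop (v.adicCompletion K) p)
    (hz : ∀ σ τ, z (σ * τ) = z σ + BdRPlusTop.galRepr (v.adicCompletion K) p σ (z τ))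
    (e_rec : ∀ τ, BdRPlusTop.of (v.adicCompletion K) p (qpToBdR ((p : ℚ_[p]) ^ k)) * g τ -
      (BdRPlusTop.of (v.adicCompletion K) p (qpToBdR ((ψ τ : ℤ_[p]) : ℚ_[p])) *
          BdRPlusTop.unitKummerLog hpv hF hu (norm_algebraMap_normedAlgClosure_le_one_of_valuation_le_one hu1.le) +
        BdRPlusTop.periodLine (v.adicCompletion K) p (h τ) + z τ) ∈
        (WithIdeal.i ^ 2 : Ideal (BdRPlusTop (v.adicCompletion K) p))) :
    letI := LocalField.padicAlgebra (v.adicCompletion K) p hpv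
    ((tatePairingPoint W (v.adicCompletion K) p e hμ hadd₁ hadd₂ hgal hcompat (oneCocycleClass _ η) P : ℤ_[p]) : ℚ_[p]) =
      -Algebra.trace ℚ_[p] (v.adicCompletion K) a := by
  rw [tatePairingPoint_eq_invPadic_cupProduct W (v.adicCompletion K) p e hμ hadd₁ hadd₂ hgal hcompat (oneCocycleClass _ η)
      (oneCocycleClass _ κ) P hκ, ContPairing.cupProduct_oneCocycleClass_eq_twoCocycleClass]
  exact invPadic_twoCocycleClass_eq_neg_trace_of_recognition_mod_sq v hpv hF ψ hψ hψlog hu hu1 a k hlog hg h z hz e_rec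

end Completion

end Literature.NumberTheory.PAdicHodge

end
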